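import Literature.IUT.HodgeArakelov.PlusMinusTowerCoverModelCore
import Literature.IUT.HodgeArakelov.PlusMinusTowerCoverModelCore2
import Literature.IUT.HodgeArakelov.PlusMinusTowerCoverModelResidual
import Literature.AnabelianGeometry.EtaleTheta.XuuCocycleNormal

/-!
# [IUTchII] Def. 2.3 (i): the `±`-tower structure `PlusMinusTower` is INHABITED BY A GENUINE TOWER at the [EtTh] model —
# NV-L6 row «PlusMinusTower», GENUINE (mod the printed inputs L02 and, for a general `X̲̲`, hN)

S. Mochizuki, *Inter-universal Teichmüller theory II*, kurims manuscript (Dec. 2020), §2, Def. 2.3 (i) p. 67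
([IUTchII] Def 2.3 (i), kurims p.67) [claim: Mochizuki2012, status: disputed] (D-0012 claim key; series status DISPUTED — classical profinite
group theory over abc-iut-L2's [EtTh] data; nothing of the series is asserted); [EtTh] §2 [cite: MochizukiEtTh2009, Def 2.1 p.36];
[SemiAnbd] §6 [cite: MochizukiSemiAnbd2006, §6 p.69].  abc-iut cell, seat abc-iut-L6-t19 gen 5 (MERGE-MAP row B14, holder-designate).
PROOF-ONLY: every witness is built INSIDE a theorem term; no `def`, no `instance`, no `structure` (the NAMED constructor
`PlusMinusTower.ofCoverModel` with its API is the def-bearing B14 file, filed separately when its gate opens).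

For abc-iut-L2-t1's `M : MuTwoSetting p` (`Π^tp_X ↪ Π^tp_C`), abc-iut-L2-d3's `e : M.CLevelData`, abc-iut-L2-t8's `C : DoubleUnderline l`
(`Π^tp_X̲̲`), the [IUTchII] §1 side data, the print-level Prop. 2.1 model `S := BadPlaceSetting.ofUnderline C μ …` (p420095: `Π_v = Π^tp_X̲̲`,
`Π^tp_{X_v} = Π^tp_X̲ = GtpXu l`; F-L6t19g5-1) and ANY Prop. 2.1 output `T : TemperedCoverings S P`:

* `PlusMinusTower.nonempty_of_completion` — from ANY injective profinite completion `ι : Π^tp_C → Q` and ANY `Φ : Q → G_{ℚ_p}` extending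
  `augC` with `Φ(Q) = G_K`, a tower with `Π̂^cor_v := Q`, `Π^cor_v := ι(Π^tp_C)`, `Π̂^±_v := cl ι(inclX Π^tp_X̲)`, `Π̂_v := cl ι(inclX Π^tp_X̲̲)`,
  `emb := ι ∘ inclX ∘ (Π^tp_X̲ ⊆ Π^tp_X) ∘ e'`, `aug := Φ|^{G_K}` (`e, e'` the identifications of the field `corresponds`); the index /
  normality fields are abc-iut-L6-t19's `PlusMinusTowerCoverModelCore2` (abc-iut-L2-t8's ambient transport p424475, abc-iut-L2-t2's index
  lemma), GRANTED **L02** `hZ` (printed definition of `Z`; for `Π^tp_X̲ ⊴ Π^tp_C`) and **hN** `Π^tp_X̲̲ ⊴ Π^tp_X̲`;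
* **`PlusMinusTower.nonempty_ofUnderline`** — hence `Nonempty (PlusMinusTower T)` (mod L02, hN), the completion and the augmentation
  being supplied by p423691 (`exists_injective_completion_of_isOpenEmbedding`) and p424688 (`exists_augHat`);
* **`PlusMinusTower.nonempty_ofCocycle`** — for abc-iut-L2-t7's COCYCLE MODEL `X̲̲ = Ξ.doubleUnderline` under `μ_l ⊆ K` the input hN is
  abc-iut-L2-t7's theorem (p422309 `doubleUnderline_normal_of_muL`): `Nonempty (PlusMinusTower T)` mod L02 ONLY.

Honest boundary: the tempered groups are abc-iut-L2's INTERFACE data; `Q` is some profinite completion of `Π^tp_C` (canonical up to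
abc-iut-L3's `extension_unique`); constructed ≠ the paper's reconstruction algorithms.  Nothing here takes a side on [IUTchIII] Cor. 3.12;
typed ≠ proved; witnessed ≠ discharged.
-/

namespace Literature.IUT.HodgeArakelov

open Literature.AnabelianGeometry.EtaleTheta Literature.AnabelianGeometry.SemiGraphs

namespace PlusMinusTower

variable {p : ℕ} [Fact p.Prime] {M : MuTwoSetting p} (e : M.CLevelData)
  {E : M.toThetaSetting.EtaleThetaData} {l : ℕ} (C : E.DoubleUnderline l) {N : ℕ+}
  (μ : M.toThetaSetting.CyclotomeMod l N) (hC : M.toThetaSetting.Compat) (hS : M.toThetaSetting.Sec2Hyps)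
  (hl : l.Prime) (hp2 : p ≠ 2) (hpl : p ≠ l) (hζ : ∃ ζ : M.toThetaSetting.K, IsPrimitiveRoot ζ (4 * l))
  {η : (C.thetaEnvData μ hC hS).PiYdd → MuN p N} (hη : η ∈ (C.thetaEnvData μ hC hS).thetaCocycles)

/-- **A genuine `±`-tower from ANY injective profinite completion of `Π^tp_C` and ANY extension of the augmentation** (see the module
docstring for the fields), GRANTED L02 (`hZ`) and hN.  PROVED (witness inside the term).
([IUTchII] Def 2.3 (i), kurims p.67) [claim: Mochizuki2012, status: disputed] -/
theorem nonempty_of_completion {Q : Type} [Group Q] [TopologicalSpace Q] [IsTopologicalGroup Q]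
    (ι : M.GtpC →ₜ* Q) (hι : IsProfiniteCompletion ι) (hinj : Function.Injective ι)
    (Φ : Q →* GQp p) (hΦ : ∀ g : M.GtpC, Φ (ι g) = e.augC g) (hΦK : Φ.range = M.GK)
    (hZ : Thm16Sub.KerToZIsCompactlyGenerated M.toThetaSetting) (hN : (C.Huu.subgroupOf (M.GtpXu l)).Normal)
    {P : TopGroup.{0}} (T : TemperedCoverings (BadPlaceSetting.ofUnderline C μ hC hS hl hp2 hpl hζ hη) P) :
    Nonempty (PlusMinusTower T) := by
  obtain ⟨eP, e', hcomm, -, -⟩ := T.corresponds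
  have hmem : ∀ q : Q, Φ q ∈ M.GK := fun q => hΦK.le (MonoidHom.mem_range.mpr ⟨q, rfl⟩)
  -- the embedding `Π^tp_{X_v}(P) ≅ Π^tp_X̲ ⊆ Π^tp_X ↪ Π^tp_C → Q`
  let emb : T.Xplain →* Q :=
    ((ι.toMonoidHom.comp M.inclX).comp (M.GtpXu l).subtype).comp (e'.toMulEquiv.toMonoidHom : T.Xplain →* (M.GtpXu l))
  have hemb : ∀ x, emb x = ι (M.inclX (e' x).1) := fun _ => rfl
  -- the augmentation, typed over the bundled groups
  let aug : TopGroup.of Q →* (BadPlaceSetting.ofUnderline C μ hC hS hl hp2 hpl hζ hη).Gk := Φ.codRestrict M.GK hmem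
  have haug : ∀ q, (aug q).1 = Φ q := fun _ => rfl
  have hker : aug.ker = Φ.ker := by
    ext q
    rw [MonoidHom.mem_ker, MonoidHom.mem_ker]
    exact ⟨fun h => (haug q).symm.trans (congrArg Subtype.val h), fun h => Subtype.ext ((haug q).trans h)⟩
  refine ⟨{ Corhat := TopGroup.of Q
            cor := ι.toMonoidHom.range
            pmHat := (((M.GtpXu l).map M.inclX).map ι.toMonoidHom).topologicalClosure
            hat := ((C.Huu.map M.inclX).map ι.toMonoidHom).topologicalClosure
            emb := emb
            emb_injective := (hinj.comp M.injective_inclX).comp (Subtype.val_injective.comp e'.injective)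
            aug := aug
            aug_surjective := ?_
            hat_le_pmHat := Subgroup.topologicalClosure_mono (Subgroup.map_mono (Subgroup.map_mono C.Huu_le_GtpXu))
            emb_le_pmHat := ?_
            embP_le_hat := ?_
            embP_le_cor := ?_
            pmHat_normal := e.normal_closure_GtpXu ι hι hZ l
            deltaHat_normal := ?_
            deltaHat_index := ?_
            deltaPmHat_normal := ?_
            deltaPmHat_index := ?_
            aug_compat := ⟨eP, fun x => Subtype.ext ?_⟩ }⟩
  · -- `aug` is onto `G_K`
    intro g
    have hg : g.1 ∈ Φ.range := by rw [hΦK]; exact g.2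
    obtain ⟨q, hq⟩ := hg
    exact ⟨q, Subtype.ext hq⟩
  · -- `emb(Π^tp_{X_v}(P)) ⊆ Π̂^±_v`
    rintro _ ⟨x, rfl⟩
    exact Subgroup.le_topologicalClosure _ ⟨M.inclX (e' x).1, ⟨_, (e' x).2, rfl⟩, rfl⟩
  · -- `emb(incl P) ⊆ Π̂_v`
    rintro _ ⟨x, rfl⟩
    refine Subgroup.le_topologicalClosure _ ⟨M.inclX (eP x).1, ⟨_, (eP x).2, rfl⟩, ?_⟩
    change _ = ι (M.inclX (e' (T.incl x)).1)
    rw [hcomm]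
    rfl
  · -- `emb(Π^tp_{X_v}(P)) ⊆ ι(Π^tp_C)`
    rintro _ ⟨x, rfl⟩
    exact ⟨_, rfl⟩
  · -- `Δ̂_v ⊴ Δ̂^±_v`
    rw [hker]
    exact MuTwoSetting.CLevelData.normal_field ι C hN Φ.ker
  · -- `[Δ̂^±_v : Δ̂_v] = l`
    rw [hker]
    exact (e.index_fields ι hι C hZ Φ hΦ hmem).2
  · -- `Δ̂^±_v ⊴ Δ̂^cor_v`
    rw [hker]
    exact e.normal_field_pm ι hι hZ Φ.ker
  · -- `[Δ̂^cor_v : Δ̂^±_v] = 2l`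
    rw [hker]
    exact (e.index_fields ι hι C hZ Φ hΦ hmem).1
  · -- compatibility of `aug` with `Π_v ↠ G_v` through `eP`
    change Φ (ι (M.inclX (e' (T.incl x)).1)) = M.aug (eP x).1
    rw [hcomm, hΦ, e.augC_inclX]
    rfl

include e in
/-- **NV-L6 «PlusMinusTower», GENUINE (mod L02, hN)**: for every Prop. 2.1 output `T` over the print-level [EtTh] model
`BadPlaceSetting.ofUnderline`, `PlusMinusTower T` is INHABITED by the tower built inside an injective profinite completion of `Π^tp_C`
(p423691) with the extended augmentation (p424688).  PROVED. ([IUTchII] Def 2.3 (i), kurims p.67) [claim: Mochizuki2012, status: disputed] -/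
theorem nonempty_ofUnderline (hZ : Thm16Sub.KerToZIsCompactlyGenerated M.toThetaSetting)
    (hN : (C.Huu.subgroupOf (M.GtpXu l)).Normal) {P : TopGroup.{0}}
    (T : TemperedCoverings (BadPlaceSetting.ofUnderline C μ hC hS hl hp2 hpl hζ hη) P) :
    Nonempty (PlusMinusTower T) := by
  haveI : M.inclX.range.Normal := M.range_inclX_normal
  haveI : M.inclX.range.FiniteIndex := ⟨by rw [M.index_range_inclX]; decide⟩
  obtain ⟨Qg, ι, hι, hinj⟩ : ∃ (Qg : ProfiniteGrp.{0}) (ι : M.GtpC →ₜ* Qg),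
      IsProfiniteCompletion ι ∧ Function.Injective ι :=
    IsProfiniteCompletion.exists_injective_completion_of_isOpenEmbedding
      M.isProfiniteCompletion_toHat M.toHat_injective M.inclX e.isOpenEmbedding_inclX
  obtain ⟨Ψ, hΨ, hΨs⟩ := e.exists_augHat ι hι
  have hrange : (M.GK.subtype.comp Ψ.toMonoidHom).range = M.GK := by
    ext g
    constructor
    · rintro ⟨q, rfl⟩
      exact (Ψ q).2
    · intro hg
      obtain ⟨q, hq⟩ := hΨs ⟨g, hg⟩
      exact ⟨q, congrArg Subtype.val hq⟩
  exact nonempty_of_completion e C μ hC hS hl hp2 hpl hζ hη ι hι hinj (M.GK.subtype.comp Ψ.toMonoidHom)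
    (fun g => hΨ g) hrange hZ hN T

end PlusMinusTower

/-! ## The cocycle model: hN discharged under `μ_l ⊆ K` -/

namespace PlusMinusTower

variable {p : ℕ} [Fact p.Prime] {M : MuTwoSetting p} (e : M.CLevelData)
  {E : M.toThetaSetting.EtaleThetaData} {l : ℕ+} (Ξ : ThetaSetting.EtaleThetaData.XuuCocycleData E l) {N : ℕ+}
  (μ : M.toThetaSetting.CyclotomeMod l N) (hC : M.toThetaSetting.Compat) (hS : M.toThetaSetting.Sec2Hyps)
  (hl : (l : ℕ).Prime) (hp2 : p ≠ 2) (hpl : p ≠ l) (hζ : ∃ ζ : M.toThetaSetting.K, IsPrimitiveRoot ζ (4 * (l : ℕ)))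
  {η : (Ξ.doubleUnderline.thetaEnvData μ hC hS).PiYdd → MuN p N}
  (hη : η ∈ (Ξ.doubleUnderline.thetaEnvData μ hC hS).thetaCocycles)

include e in
/-- **NV-L6 «PlusMinusTower», GENUINE for abc-iut-L2-t7's COCYCLE MODEL `X̲̲` (mod L02 only)**: when `K ⊇ μ_l` ([EtTh] Rmk. 2.6.1), the
arithmetic normality `Π^tp_X̲̲ ⊴ Π^tp_X̲` of the zero-locus `X̲̲ = Ξ.doubleUnderline` is abc-iut-L2-t7's theorem `doubleUnderline_normal_of_muL`
(p422309), so `PlusMinusTower T` is inhabited for every Prop. 2.1 output `T` over `BadPlaceSetting.ofUnderline Ξ.doubleUnderline …`, granted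
only L02.  PROVED. ([IUTchII] Def 2.3 (i), kurims p.67) [claim: Mochizuki2012, status: disputed] -/
theorem nonempty_ofCocycle (μ₁ : M.toThetaSetting.CyclotomeMod 1 l)
    (hμK : ∀ ζ : MuN p l, (((ζ : (PadicAlgCl p)ˣ) : PadicAlgCl p)) ∈ M.toThetaSetting.K)
    (hZ : Thm16Sub.KerToZIsCompactlyGenerated M.toThetaSetting) {P : TopGroup.{0}}
    (T : TemperedCoverings (BadPlaceSetting.ofUnderline Ξ.doubleUnderline μ hC hS hl hp2 hpl hζ hη) P) :
    Nonempty (PlusMinusTower T) :=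
  nonempty_ofUnderline e Ξ.doubleUnderline μ hC hS hl hp2 hpl hζ hη hZ (Ξ.doubleUnderline_normal_of_muL μ₁ hμK) T

end PlusMinusTower

end Literature.IUT.HodgeArakelov
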